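import Summits.CriticalPhenomena.PercolationContinuityZ3.Theorems.PercNearOneGluingAdditiveGluingSepCaptureAux
import Mathlib.Combinatorics.SetFamily.FourFunctions
import HarnessLib

/-!
# Crux `PercNearOneGluing.AdditiveGluing` (stmt-CriticalPhenomena-4576) — the Ahlswede–Daykin / Harris
# four-event inequality for three-terminal connectivity events CONDITIONED ON THE ISOLATION of vertex sets
# — part I: the induction on `G[U]`

Helper file (task `png-dp-al5`, gen 3; `--supports stmt-CriticalPhenomena-4576`); generalises
`…SepCapture.lean` (whose `sepCapture_two_sets` is the instance `A₁ = {o↔a}`, `D₁ = {o↮b, a↮b}`,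
`A₂ = {o↔b}`, `D₂ = {o↮a, a↮b}` of the theorem below).

Bond percolation with arbitrary edge probabilities on a finite vertex type (`μ = prodBernoulli w`), three
vertices `o, a, b` ("terminals").  A TERMINAL EVENT is an event of the form
`{ω | P (o↔a) (o↔b) (a↔b)}` for a predicate `P` of the three connection relations among the terminals; it is
increasing if `P` is monotone in each argument, decreasing if antitone (hypotheses spelled out; no
definition is introduced).  For a vertex set `W` write
`I_W = {o,a,b} ↮ W = {∀ x ∈ W, o↮x} ∩ {∀ x ∈ W, a↮x} ∩ {∀ x ∈ W, b↮x}`.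

**Theorem (`condAD_two_sets`).**  For increasing terminal events `A₁, A₂`, decreasing terminal events
`D₁, D₂` and vertex sets `S, T`:

  `μ(A₁ ∩ D₁ ∩ I_S) · μ(A₂ ∩ D₂ ∩ I_T) ≤ μ(A₁ ∩ A₂ ∩ I_{S∩T}) · μ(D₁ ∩ D₂ ∩ I_{S∪T})`.

For `S = T = ∅` this is the Ahlswede–Daykin four-event inequality (Harris–FKG in product form); the point is
that it SURVIVES CONDITIONING ON THE ISOLATION EVENTS `I_S, I_T` (decreasing events, for which no FKG
structure is available in general), with the intersection/union bookkeeping of van den Berg–Kahn 2001 /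
BHK 2006 Thm. 1.1.  Corollaries (`S = T = W`): given `I_W`, increasing terminal events are positively
correlated (`condHarris_isolated`), and the separated-capture inequality
`P(oa|b|c)·P(ob|a|c) ≤ P(oab|c)·P(o|a|b|c)` of `…SepCapture.lean`.  The terminal events are NOT measurable
with respect to the cluster of one vertex (or two), so this is not a case of BHK's Thms. 1.1–1.5; and given
`I_W` the join of two configurations does not preserve `I_W`, so it is not a case of Ahlswede–Daykin either.

## Proof

Verbatim the induction of `…SepCapture.lean` / `BHK2006.core` ([VandenbergKahn2001, proof of Thm. 1.2];
[VandenbergHaggstromKahn2005, Thm. 1.1, pp. 3–5]): strong induction on the vertex set `U` of the restricted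
model `G[U]`; if `Z := S ∩ T ∩ U = ∅`, the four functions theorem on the configuration lattice (the join of
`α ∈ A₁ ∩ D₁ ∩ I_S` and `β ∈ A₂ ∩ D₂ ∩ I_T` lies in `A₁ ∩ A₂`, the meet in `D₁ ∩ D₂ ∩ I_{S∪T}`, by the
monotonicity of the predicates and of restricted reachability); otherwise condition on the set `R` of
vertices of `U ∖ Z` with an open edge to `Z`: on `I_Z` every terminal event of `G[U]` is the same terminal
event of `G[U ∖ Z]` and `I_W` becomes `I_{(W∖Z) ∪ R}` (BHK's identity (6) for the three sources, file
`…SepCaptureAux`), the law of `R` is a product weight, and Ahlswede–Daykin over `R` with the induction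
hypothesis for `G[U ∖ Z]` closes the step.

## References
* J. van den Berg, J. Kahn, Ann. Probab. 29 (2001) 123–126, Thm. 1.2 and its proof. [VandenbergKahn2001]
* J. van den Berg, O. Häggström, J. Kahn, RSA 29 (2006) 417–435, Thm. 1.1 (pp. 3–5). [VandenbergHaggstromKahn2005]
* R. Ahlswede, D. E. Daykin (1978) (Mathlib `four_functions_theorem_univ`).
-/

noncomputable section

open MeasureTheory
open Literature.Probability.LatticeModels (prodBernoulli)
open Literature.Probability.Percolation
open Literature.Probability.Percolation.BHK2006
open DecisionTree (ind ind_of_mem ind_of_not_mem ind_nonneg)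

namespace Summit.CriticalPhenomena.PercolationContinuityZ3.Theorems

open scoped Classical

variable {V : Type*}

/-! Local notations (no new definitions): `rR[U, x, y]` = `{x ↔ y in G[U]}`; `rAV[U, o, a, b, W]` = the
isolation event `{o,a,b} ↮ W` in `G[U]`; `rEV[U, o, a, b, P]` = the terminal event of the predicate `P` in
`G[U]`. -/
local notation3 "rR[" U ", " x ", " y "]" =>
  {ω : Set (Sym2 V) | (openGraph (ω ∩ edgesIn U)).Reachable x y}
local notation3 "rAV[" U ", " o ", " a ", " b ", " W "]" => rD U o W ∩ rD U a W ∩ rD U b W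
local notation3 "rEV[" U ", " o ", " a ", " b ", " P "]" =>
  {ω : Set (Sym2 V) | (P : Prop → Prop → Prop → Prop) ((openGraph (ω ∩ edgesIn U)).Reachable o a)
    ((openGraph (ω ∩ edgesIn U)).Reachable o b) ((openGraph (ω ∩ edgesIn U)).Reachable a b)}

/-! Monotonicity of a terminal predicate `P : Prop → Prop → Prop → Prop` ("increasing terminal event") is the
hypothesis `∀ p p' q q' r r', (p → p') → (q → q') → (r → r') → P p q r → P p' q' r'`; antitonicity
("decreasing") has the implications reversed.  (Spelled out; no definition is introduced.) -/

section Events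

/-- Terminal events of `G[U ∖ Z]` do not read the edges meeting `Z`. [folklore] -/
theorem condAD_ev_diff_meeting (U Z : Finset V) (o a b : V) (P : Prop → Prop → Prop → Prop)
    (ω : Set (Sym2 V)) :
    ω \ meeting Z ∈ rEV[U \ Z, o, a, b, P] ↔ ω ∈ rEV[U \ Z, o, a, b, P] := by
  simp only [Set.mem_setOf_eq, sepCapture_reach_diff_meeting]

/-- BHK's identity (6) for terminal events: on the restricted isolation event (all three terminals avoid
`S(ω)` in `G[U ∖ Z]`), a terminal event of `G[U]` is the same terminal event of `G[U ∖ Z]`.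
[cite: VandenbergHaggstromKahn2005, §1 p. 4, identity (6)] -/
theorem condAD_ev_iff {U Z : Finset V} {o a b : V} (ho : o ∉ Z) (ha : a ∉ Z)
    (P : Prop → Prop → Prop → Prop) {W' : Set V} {ω : Set (Sym2 V)}
    (hav' : ω ∈ rAV[U \ Z, o, a, b, W' ∪ rS U Z ω]) :
    ω ∈ rEV[U, o, a, b, P] ↔ ω ∈ rEV[U \ Z, o, a, b, P] := by
  have hSo := sepCapture_avoid_rS hav'.1.1
  have hSa := sepCapture_avoid_rS hav'.1.2
  simp only [Set.mem_setOf_eq]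
  rw [propext (SandwichK41.reachable_restrict_iff ho hSo a),
    propext (SandwichK41.reachable_restrict_iff ho hSo b),
    propext (SandwichK41.reachable_restrict_iff ha hSa b)]

/-- The compound event `P ∩ Q ∩ I_W` of `G[U ∖ Z]` does not read the edges meeting `Z`. [folklore] -/
theorem condAD_E_diff_meeting (U Z : Finset V) (o a b : V) (P Q : Prop → Prop → Prop → Prop) (W : Set V)
    (ω : Set (Sym2 V)) :
    ω \ meeting Z ∈ rEV[U \ Z, o, a, b, P] ∩ rEV[U \ Z, o, a, b, Q] ∩ rAV[U \ Z, o, a, b, W] ↔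
      ω ∈ rEV[U \ Z, o, a, b, P] ∩ rEV[U \ Z, o, a, b, Q] ∩ rAV[U \ Z, o, a, b, W] := by
  simp only [Set.mem_inter_iff, condAD_ev_diff_meeting, mem_rD_diff_meeting]

/-- BHK's (6) for the compound events: for `Z ⊆ W` avoiding the terminals,
`ω ∈ P ∩ Q ∩ I_W` in `G[U]` iff `ω ∈ P ∩ Q ∩ I_{(W∖Z) ∪ S(ω)}` in `G[U ∖ Z]`.
[cite: VandenbergHaggstromKahn2005, §1 p. 4, identity (6)] -/
theorem condAD_E_iff {U Z : Finset V} (hZU : Z ⊆ U) {o a b : V} (ho : o ∉ Z) (ha : a ∉ Z)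
    (hb : b ∉ Z) (P Q : Prop → Prop → Prop → Prop) {W : Set V} (hZW : (↑Z : Set V) ⊆ W)
    (ω : Set (Sym2 V)) :
    ω ∈ rEV[U, o, a, b, P] ∩ rEV[U, o, a, b, Q] ∩ rAV[U, o, a, b, W] ↔
      ω ∈ rEV[U \ Z, o, a, b, P] ∩ rEV[U \ Z, o, a, b, Q] ∩
        rAV[U \ Z, o, a, b, (W \ ↑Z) ∪ rS U Z ω] := by
  constructor
  · rintro ⟨⟨hP, hQ⟩, hav⟩
    have hav' := (sepCapture_av_iff hZU ho ha hb hZW ω).1 hav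
    exact ⟨⟨(condAD_ev_iff ho ha P hav').1 hP, (condAD_ev_iff ho ha Q hav').1 hQ⟩, hav'⟩
  · rintro ⟨⟨hP, hQ⟩, hav'⟩
    exact ⟨⟨(condAD_ev_iff ho ha P hav').2 hP, (condAD_ev_iff ho ha Q hav').2 hQ⟩,
      (sepCapture_av_iff hZU ho ha hb hZW ω).2 hav'⟩

variable [Fintype V]

/-! ### The induction -/

/-- **Conditional Ahlswede–Daykin for terminal events, restricted to `G[U]`, two isolation sets.**
For increasing terminal predicates `A₁, A₂`, decreasing `D₁, D₂` and `S, T ⊆ U`: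
`μ(A₁ ∩ D₁ ∩ I_S) · μ(A₂ ∩ D₂ ∩ I_T) ≤ μ(A₁ ∩ A₂ ∩ I_{S∩T}) · μ(D₁ ∩ D₂ ∩ I_{S∪T})` (weight sums in `G[U]`).
[cite: VandenbergKahn2001, Thm. 1.2 (pp. 124–126) — method; derived in this file] -/
theorem condAD_core (w : Sym2 V → ℝ) (hw0 : ∀ e, 0 ≤ w e) (hw1 : ∀ e, w e ≤ 1)
    (hm : ∑ ω, weight w ω = 1) (U : Finset V) :
    ∀ (o a b : V) (A₁ A₂ D₁ D₂ : Prop → Prop → Prop → Prop),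
    (∀ (p p' q q' r r' : Prop), (p → p') → (q → q') → (r → r') → A₁ p q r → A₁ p' q' r') →
    (∀ (p p' q q' r r' : Prop), (p → p') → (q → q') → (r → r') → A₂ p q r → A₂ p' q' r') →
    (∀ (p p' q q' r r' : Prop), (p' → p) → (q' → q) → (r' → r) → D₁ p q r → D₁ p' q' r') →
    (∀ (p p' q q' r r' : Prop), (p' → p) → (q' → q) → (r' → r) → D₂ p q r → D₂ p' q' r') →
    ∀ (S T : Set V), S ⊆ ↑U → T ⊆ ↑U →
    (∑ ω, weight w ω * ind (rEV[U, o, a, b, A₁] ∩ rEV[U, o, a, b, D₁] ∩ rAV[U, o, a, b, S]) ω) *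
      (∑ ω, weight w ω * ind (rEV[U, o, a, b, A₂] ∩ rEV[U, o, a, b, D₂] ∩ rAV[U, o, a, b, T]) ω) ≤
    (∑ ω, weight w ω * ind (rEV[U, o, a, b, A₁] ∩ rEV[U, o, a, b, A₂] ∩ rAV[U, o, a, b, S ∩ T]) ω) *
      (∑ ω, weight w ω *
        ind (rEV[U, o, a, b, D₁] ∩ rEV[U, o, a, b, D₂] ∩ rAV[U, o, a, b, S ∪ T]) ω) := by
  induction U using Finset.strongInduction with
  | H U ih =>
  intro o a b A₁ A₂ D₁ D₂ hA₁ hA₂ hD₁ hD₂ S T hSU hTU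
  have hRHS : 0 ≤ (∑ ω, weight w ω *
      ind (rEV[U, o, a, b, A₁] ∩ rEV[U, o, a, b, A₂] ∩ rAV[U, o, a, b, S ∩ T]) ω) *
      (∑ ω, weight w ω *
        ind (rEV[U, o, a, b, D₁] ∩ rEV[U, o, a, b, D₂] ∩ rAV[U, o, a, b, S ∪ T]) ω) :=
    mul_nonneg (sepCapture_sum_nonneg hw0 hw1 _) (sepCapture_sum_nonneg hw0 hw1 _)
  -- trivial cases: a terminal lies in `S` (resp. `T`)
  have hempty : ∀ (P Q : Prop → Prop → Prop → Prop) (W : Set V), (o ∈ W ∨ a ∈ W ∨ b ∈ W) →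
      ∑ ω, weight w ω * ind (rEV[U, o, a, b, P] ∩ rEV[U, o, a, b, Q] ∩ rAV[U, o, a, b, W]) ω = 0 := by
    intro P Q W hW
    refine Finset.sum_eq_zero fun ω _ => ?_
    have hω : ω ∉ rEV[U, o, a, b, P] ∩ rEV[U, o, a, b, Q] ∩ rAV[U, o, a, b, W] := by
      rintro ⟨-, ⟨⟨h1, h2⟩, h3⟩⟩
      rcases hW with h | h | h
      · exact (rD_eq_empty (U := U) (s := o) h).le h1
      · exact (rD_eq_empty (U := U) (s := a) h).le h2
      · exact (rD_eq_empty (U := U) (s := b) h).le h3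
    rw [ind_of_not_mem hω, mul_zero]
  by_cases hS3 : o ∈ S ∨ a ∈ S ∨ b ∈ S
  · rw [hempty A₁ D₁ S hS3, zero_mul]; exact hRHS
  by_cases hT3 : o ∈ T ∨ a ∈ T ∨ b ∈ T
  · rw [hempty A₂ D₂ T hT3, mul_zero]; exact hRHS
  push Not at hS3 hT3
  obtain ⟨hoS, haS, hbS⟩ := hS3
  obtain ⟨hoT, haT, hbT⟩ := hT3
  set Z : Finset V := U.filter fun v => v ∈ S ∧ v ∈ T with hZ
  have hZU : Z ⊆ U := Finset.filter_subset _ _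
  have hmemZ : ∀ v, v ∈ Z ↔ v ∈ S ∧ v ∈ T := fun v => by
    simp only [hZ, Finset.mem_filter, and_iff_right_iff_imp]
    exact fun h => hSU h.1
  have hoZ : o ∉ Z := fun h => hoS ((hmemZ o).1 h).1
  have haZ : a ∉ Z := fun h => haS ((hmemZ a).1 h).1
  have hbZ : b ∉ Z := fun h => hbS ((hmemZ b).1 h).1
  -- monotonicity of restricted reachability under `∩` / `∪` of configurations
  have rmono : ∀ {α β : Set (Sym2 V)}, α ⊆ β → ∀ x y : V,
      (openGraph (α ∩ edgesIn U)).Reachable x y → (openGraph (β ∩ edgesIn U)).Reachable x y :=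
    fun h x y hr => hr.mono (openGraph_le (Set.inter_subset_inter_left _ h))
  rcases Z.eq_empty_or_nonempty with hZe | hZne
  · /- `S ∩ T = ∅`: Ahlswede–Daykin on the configuration lattice. -/
    have hST : ∀ v, v ∈ S ∩ T → False := fun v hv => by
      have : v ∈ Z := (hmemZ v).2 hv
      rw [hZe] at this
      exact Finset.notMem_empty v this
    have key := four_functions_theorem_univ
      (fun ω => weight w ω * ind (rEV[U, o, a, b, A₁] ∩ rEV[U, o, a, b, D₁] ∩ rAV[U, o, a, b, S]) ω)
      (fun ω => weight w ω * ind (rEV[U, o, a, b, A₂] ∩ rEV[U, o, a, b, D₂] ∩ rAV[U, o, a, b, T]) ω)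
      (fun ω => weight w ω *
        ind (rEV[U, o, a, b, D₁] ∩ rEV[U, o, a, b, D₂] ∩ rAV[U, o, a, b, S ∪ T]) ω)
      (fun ω => weight w ω *
        ind (rEV[U, o, a, b, A₁] ∩ rEV[U, o, a, b, A₂] ∩ rAV[U, o, a, b, S ∩ T]) ω)
      (fun ω => mul_nonneg (weight_nonneg hw0 hw1 ω) (ind_nonneg _ _))
      (fun ω => mul_nonneg (weight_nonneg hw0 hw1 ω) (ind_nonneg _ _))
      (fun ω => mul_nonneg (weight_nonneg hw0 hw1 ω) (ind_nonneg _ _))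
      (fun ω => mul_nonneg (weight_nonneg hw0 hw1 ω) (ind_nonneg _ _))
      (fun α β => ?_)
    · rw [mul_comm (∑ ω, weight w ω *
        ind (rEV[U, o, a, b, A₁] ∩ rEV[U, o, a, b, A₂] ∩ rAV[U, o, a, b, S ∩ T]) ω)]
      exact key
    by_cases hα : α ∈ rEV[U, o, a, b, A₁] ∩ rEV[U, o, a, b, D₁] ∩ rAV[U, o, a, b, S]
    · by_cases hβ : β ∈ rEV[U, o, a, b, A₂] ∩ rEV[U, o, a, b, D₂] ∩ rAV[U, o, a, b, T]
      · obtain ⟨⟨hαA, hαD⟩, ⟨⟨hoS', haS'⟩, hbS'⟩⟩ := hα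
        obtain ⟨⟨hβA, hβD⟩, ⟨⟨hoT', haT'⟩, hbT'⟩⟩ := hβ
        have hmeet : α ⊓ β ∈ rEV[U, o, a, b, D₁] ∩ rEV[U, o, a, b, D₂] ∩ rAV[U, o, a, b, S ∪ T] := by
          refine ⟨⟨?_, ?_⟩, ?_⟩
          · exact hD₁ _ _ _ _ _ _ (rmono Set.inter_subset_left o a) (rmono Set.inter_subset_left o b)
              (rmono Set.inter_subset_left a b) hαD
          · exact hD₂ _ _ _ _ _ _ (rmono Set.inter_subset_right o a) (rmono Set.inter_subset_right o b)
              (rmono Set.inter_subset_right a b) hβD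
          refine ⟨⟨?_, ?_⟩, ?_⟩
          · rw [rD_union]
            exact ⟨rD_decreasing Set.inter_subset_left hoS', rD_decreasing Set.inter_subset_right hoT'⟩
          · rw [rD_union]
            exact ⟨rD_decreasing Set.inter_subset_left haS', rD_decreasing Set.inter_subset_right haT'⟩
          · rw [rD_union]
            exact ⟨rD_decreasing Set.inter_subset_left hbS', rD_decreasing Set.inter_subset_right hbT'⟩
        have hjoin : α ⊔ β ∈ rEV[U, o, a, b, A₁] ∩ rEV[U, o, a, b, A₂] ∩ rAV[U, o, a, b, S ∩ T] := by
          refine ⟨⟨?_, ?_⟩, ?_⟩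
          · exact hA₁ _ _ _ _ _ _ (rmono Set.subset_union_left o a) (rmono Set.subset_union_left o b)
              (rmono Set.subset_union_left a b) hαA
          · exact hA₂ _ _ _ _ _ _ (rmono Set.subset_union_right o a) (rmono Set.subset_union_right o b)
              (rmono Set.subset_union_right a b) hβA
          · exact ⟨⟨fun v hv _ => hST v hv, fun v hv _ => hST v hv⟩, fun v hv _ => hST v hv⟩
        have e1 : ind (rEV[U, o, a, b, A₁] ∩ rEV[U, o, a, b, D₁] ∩ rAV[U, o, a, b, S]) α = 1 :=
          ind_of_mem ⟨⟨hαA, hαD⟩, ⟨⟨hoS', haS'⟩, hbS'⟩⟩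
        have e2 : ind (rEV[U, o, a, b, A₂] ∩ rEV[U, o, a, b, D₂] ∩ rAV[U, o, a, b, T]) β = 1 :=
          ind_of_mem ⟨⟨hβA, hβD⟩, ⟨⟨hoT', haT'⟩, hbT'⟩⟩
        rw [e1, e2, ind_of_mem hmeet, ind_of_mem hjoin, mul_one, mul_one, mul_one, mul_one]
        exact (weight_inter_mul_union w α β).le
      · rw [ind_of_not_mem hβ, mul_zero, mul_zero]
        exact mul_nonneg (mul_nonneg (weight_nonneg hw0 hw1 _) (ind_nonneg _ _))
          (mul_nonneg (weight_nonneg hw0 hw1 _) (ind_nonneg _ _))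
    · rw [ind_of_not_mem hα, mul_zero, zero_mul]
      exact mul_nonneg (mul_nonneg (weight_nonneg hw0 hw1 _) (ind_nonneg _ _))
        (mul_nonneg (weight_nonneg hw0 hw1 _) (ind_nonneg _ _))
  · /- `Z ≠ ∅`: condition on `S(ω)`; four functions theorem with the induction hypothesis on `U ∖ Z`. -/
    have hss : U \ Z ⊂ U := Finset.sdiff_ssubset hZU hZne
    have hZS : (↑Z : Set V) ⊆ S := fun v hv => ((hmemZ v).1 hv).1
    have hZT : (↑Z : Set V) ⊆ T := fun v hv => ((hmemZ v).1 hv).2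
    have hZST : (↑Z : Set V) ⊆ S ∩ T := fun v hv => (hmemZ v).1 hv
    have hZSuT : (↑Z : Set V) ⊆ S ∪ T := fun v hv => Or.inl ((hmemZ v).1 hv).1
    have e1 := sepCapture_step_sum w hm
      (rEV[U, o, a, b, A₁] ∩ rEV[U, o, a, b, D₁] ∩ rAV[U, o, a, b, S])
      (fun W => rEV[U \ Z, o, a, b, A₁] ∩ rEV[U \ Z, o, a, b, D₁] ∩ rAV[U \ Z, o, a, b, W]) (S \ ↑Z)
      (fun R ω => condAD_E_diff_meeting U Z o a b A₁ D₁ _ ω)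
      (fun ω => condAD_E_iff hZU hoZ haZ hbZ A₁ D₁ hZS ω)
    have e2 := sepCapture_step_sum w hm
      (rEV[U, o, a, b, A₂] ∩ rEV[U, o, a, b, D₂] ∩ rAV[U, o, a, b, T])
      (fun W => rEV[U \ Z, o, a, b, A₂] ∩ rEV[U \ Z, o, a, b, D₂] ∩ rAV[U \ Z, o, a, b, W]) (T \ ↑Z)
      (fun R ω => condAD_E_diff_meeting U Z o a b A₂ D₂ _ ω)
      (fun ω => condAD_E_iff hZU hoZ haZ hbZ A₂ D₂ hZT ω)
    have e3 := sepCapture_step_sum w hm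
      (rEV[U, o, a, b, A₁] ∩ rEV[U, o, a, b, A₂] ∩ rAV[U, o, a, b, S ∩ T])
      (fun W => rEV[U \ Z, o, a, b, A₁] ∩ rEV[U \ Z, o, a, b, A₂] ∩ rAV[U \ Z, o, a, b, W])
      ((S ∩ T) \ ↑Z)
      (fun R ω => condAD_E_diff_meeting U Z o a b A₁ A₂ _ ω)
      (fun ω => condAD_E_iff hZU hoZ haZ hbZ A₁ A₂ hZST ω)
    have e4 := sepCapture_step_sum w hm
      (rEV[U, o, a, b, D₁] ∩ rEV[U, o, a, b, D₂] ∩ rAV[U, o, a, b, S ∪ T])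
      (fun W => rEV[U \ Z, o, a, b, D₁] ∩ rEV[U \ Z, o, a, b, D₂] ∩ rAV[U \ Z, o, a, b, W])
      ((S ∪ T) \ ↑Z)
      (fun R ω => condAD_E_diff_meeting U Z o a b D₁ D₂ _ ω)
      (fun ω => condAD_E_iff hZU hoZ haZ hbZ D₁ D₂ hZSuT ω)
    rw [e1, e2, e3, e4]
    refine four_functions_theorem_univ
      (fun ω => weight w ω * ∑ η, weight w η *
        ind (rEV[U \ Z, o, a, b, A₁] ∩ rEV[U \ Z, o, a, b, D₁] ∩ rAV[U \ Z, o, a, b, S \ ↑Z ∪ rS U Z ω]) η)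
      (fun ω => weight w ω * ∑ η, weight w η *
        ind (rEV[U \ Z, o, a, b, A₂] ∩ rEV[U \ Z, o, a, b, D₂] ∩ rAV[U \ Z, o, a, b, T \ ↑Z ∪ rS U Z ω]) η)
      (fun ω => weight w ω * ∑ η, weight w η *
        ind (rEV[U \ Z, o, a, b, A₁] ∩ rEV[U \ Z, o, a, b, A₂] ∩
          rAV[U \ Z, o, a, b, (S ∩ T) \ ↑Z ∪ rS U Z ω]) η)
      (fun ω => weight w ω * ∑ η, weight w η *
        ind (rEV[U \ Z, o, a, b, D₁] ∩ rEV[U \ Z, o, a, b, D₂] ∩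
          rAV[U \ Z, o, a, b, (S ∪ T) \ ↑Z ∪ rS U Z ω]) η)
      (fun ω => mul_nonneg (weight_nonneg hw0 hw1 ω) (sepCapture_sum_nonneg hw0 hw1 _))
      (fun ω => mul_nonneg (weight_nonneg hw0 hw1 ω) (sepCapture_sum_nonneg hw0 hw1 _))
      (fun ω => mul_nonneg (weight_nonneg hw0 hw1 ω) (sepCapture_sum_nonneg hw0 hw1 _))
      (fun ω => mul_nonneg (weight_nonneg hw0 hw1 ω) (sepCapture_sum_nonneg hw0 hw1 _))
      fun α β => ?_
    set Ra := rS U Z α with hRa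
    set Rb := rS U Z β with hRb
    have hRaU : Ra ⊆ ↑(U \ Z) := rS_subset U Z α
    have hRbU : Rb ⊆ ↑(U \ Z) := rS_subset U Z β
    have hS1 : S \ ↑Z ∪ Ra ⊆ ↑(U \ Z) := Set.union_subset
      (fun v hv => by rw [Finset.coe_sdiff]; exact ⟨hSU hv.1, hv.2⟩) hRaU
    have hT1 : T \ ↑Z ∪ Rb ⊆ ↑(U \ Z) := Set.union_subset
      (fun v hv => by rw [Finset.coe_sdiff]; exact ⟨hTU hv.1, hv.2⟩) hRbU
    have IH := ih (U \ Z) hss o a b A₁ A₂ D₁ D₂ hA₁ hA₂ hD₁ hD₂ (S \ ↑Z ∪ Ra) (T \ ↑Z ∪ Rb) hS1 hT1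
    have hsub3 : (S ∩ T) \ ↑Z ∪ rS U Z (α ∩ β) ⊆ (S \ ↑Z ∪ Ra) ∩ (T \ ↑Z ∪ Rb) := by
      refine Set.union_subset (fun v hv => ⟨Or.inl ⟨hv.1.1, hv.2⟩, Or.inl ⟨hv.1.2, hv.2⟩⟩) ?_
      exact fun v hv =>
        ⟨Or.inr (rS_inter_subset U Z α β hv).1, Or.inr (rS_inter_subset U Z α β hv).2⟩
    have hsub4 : (S ∪ T) \ ↑Z ∪ rS U Z (α ∪ β) ⊆ (S \ ↑Z ∪ Ra) ∪ (T \ ↑Z ∪ Rb) := by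
      rw [rS_union]
      rintro v (⟨hv | hv, hvZ⟩ | hv | hv)
      · exact Or.inl (Or.inl ⟨hv, hvZ⟩)
      · exact Or.inr (Or.inl ⟨hv, hvZ⟩)
      · exact Or.inl (Or.inr hv)
      · exact Or.inr (Or.inr hv)
    have h3 : ∑ η, weight w η * ind (rEV[U \ Z, o, a, b, A₁] ∩ rEV[U \ Z, o, a, b, A₂] ∩
          rAV[U \ Z, o, a, b, (S \ ↑Z ∪ Ra) ∩ (T \ ↑Z ∪ Rb)]) η ≤
        ∑ η, weight w η * ind (rEV[U \ Z, o, a, b, A₁] ∩ rEV[U \ Z, o, a, b, A₂] ∩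
          rAV[U \ Z, o, a, b, (S ∩ T) \ ↑Z ∪ rS U Z (α ∩ β)]) η :=
      sepCapture_sum_mono hw0 hw1 (Set.inter_subset_inter_right _
        (sepCapture_av_antitone (U \ Z) o a b hsub3))
    have h4 : ∑ η, weight w η * ind (rEV[U \ Z, o, a, b, D₁] ∩ rEV[U \ Z, o, a, b, D₂] ∩
          rAV[U \ Z, o, a, b, (S \ ↑Z ∪ Ra) ∪ (T \ ↑Z ∪ Rb)]) η ≤
        ∑ η, weight w η * ind (rEV[U \ Z, o, a, b, D₁] ∩ rEV[U \ Z, o, a, b, D₂] ∩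
          rAV[U \ Z, o, a, b, (S ∪ T) \ ↑Z ∪ rS U Z (α ∪ β)]) η :=
      sepCapture_sum_mono hw0 hw1 (Set.inter_subset_inter_right _
        (sepCapture_av_antitone (U \ Z) o a b hsub4))
    have hIH' : (∑ η, weight w η * ind (rEV[U \ Z, o, a, b, A₁] ∩ rEV[U \ Z, o, a, b, D₁] ∩
          rAV[U \ Z, o, a, b, S \ ↑Z ∪ Ra]) η) *
        (∑ η, weight w η * ind (rEV[U \ Z, o, a, b, A₂] ∩ rEV[U \ Z, o, a, b, D₂] ∩
          rAV[U \ Z, o, a, b, T \ ↑Z ∪ Rb]) η) ≤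
        (∑ η, weight w η * ind (rEV[U \ Z, o, a, b, A₁] ∩ rEV[U \ Z, o, a, b, A₂] ∩
          rAV[U \ Z, o, a, b, (S ∩ T) \ ↑Z ∪ rS U Z (α ∩ β)]) η) *
          (∑ η, weight w η * ind (rEV[U \ Z, o, a, b, D₁] ∩ rEV[U \ Z, o, a, b, D₂] ∩
            rAV[U \ Z, o, a, b, (S ∪ T) \ ↑Z ∪ rS U Z (α ∪ β)]) η) :=
      IH.trans (mul_le_mul h3 h4 (sepCapture_sum_nonneg hw0 hw1 _) (sepCapture_sum_nonneg hw0 hw1 _))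
    have hwab := weight_inter_mul_union w α β
    show weight w α * (∑ η, weight w η * ind (rEV[U \ Z, o, a, b, A₁] ∩ rEV[U \ Z, o, a, b, D₁] ∩
          rAV[U \ Z, o, a, b, S \ ↑Z ∪ Ra]) η) *
        (weight w β * ∑ η, weight w η * ind (rEV[U \ Z, o, a, b, A₂] ∩ rEV[U \ Z, o, a, b, D₂] ∩
          rAV[U \ Z, o, a, b, T \ ↑Z ∪ Rb]) η) ≤
      weight w (α ∩ β) * (∑ η, weight w η * ind (rEV[U \ Z, o, a, b, A₁] ∩ rEV[U \ Z, o, a, b, A₂] ∩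
          rAV[U \ Z, o, a, b, (S ∩ T) \ ↑Z ∪ rS U Z (α ∩ β)]) η) *
        (weight w (α ∪ β) * ∑ η, weight w η * ind (rEV[U \ Z, o, a, b, D₁] ∩ rEV[U \ Z, o, a, b, D₂] ∩
          rAV[U \ Z, o, a, b, (S ∪ T) \ ↑Z ∪ rS U Z (α ∪ β)]) η)
    calc weight w α * (∑ η, weight w η * ind (rEV[U \ Z, o, a, b, A₁] ∩ rEV[U \ Z, o, a, b, D₁] ∩
            rAV[U \ Z, o, a, b, S \ ↑Z ∪ Ra]) η) *
          (weight w β * ∑ η, weight w η * ind (rEV[U \ Z, o, a, b, A₂] ∩ rEV[U \ Z, o, a, b, D₂] ∩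
            rAV[U \ Z, o, a, b, T \ ↑Z ∪ Rb]) η)
        = (weight w α * weight w β) *
          ((∑ η, weight w η * ind (rEV[U \ Z, o, a, b, A₁] ∩ rEV[U \ Z, o, a, b, D₁] ∩
              rAV[U \ Z, o, a, b, S \ ↑Z ∪ Ra]) η) *
            ∑ η, weight w η * ind (rEV[U \ Z, o, a, b, A₂] ∩ rEV[U \ Z, o, a, b, D₂] ∩
              rAV[U \ Z, o, a, b, T \ ↑Z ∪ Rb]) η) := by ring
      _ ≤ (weight w (α ∩ β) * weight w (α ∪ β)) *
          ((∑ η, weight w η * ind (rEV[U \ Z, o, a, b, A₁] ∩ rEV[U \ Z, o, a, b, A₂] ∩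
              rAV[U \ Z, o, a, b, (S ∩ T) \ ↑Z ∪ rS U Z (α ∩ β)]) η) *
            ∑ η, weight w η * ind (rEV[U \ Z, o, a, b, D₁] ∩ rEV[U \ Z, o, a, b, D₂] ∩
              rAV[U \ Z, o, a, b, (S ∪ T) \ ↑Z ∪ rS U Z (α ∪ β)]) η) := by
          rw [hwab]
          exact mul_le_mul_of_nonneg_left hIH'
            (mul_nonneg (weight_nonneg hw0 hw1 _) (weight_nonneg hw0 hw1 _))
      _ = _ := by ring

end Events

end Summit.CriticalPhenomena.PercolationContinuityZ3.Theorems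

end
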